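import Mathlib
import HarnessLib
import Summits.Ventures.LatticeQCDFlow.Exactness.LatticeSitePolynomialLaplacian

/-!
# Lüscher's operator on the lattice polynomials is triangular: `𝔏 m = λ(m)·m − (lower degree)` with `λ(m) = Σ_n c_n (c_n + d − 2)` for a site monomial with `c_n` factors at site `n`

HONEST FRAMING: exact (Metropolis-corrected) sampling algorithms for lattice gauge theory;
figures of merit are autocorrelation/cost numbers at stated couplings and volumes; no
continuum-physics claim.

Venture `LatticeQCDFlow` (cell pub-lqcd), topic `Exactness`; FANOUT row 7 (`s0-cpn-null`: the
S0-D1 rung — 2D CP⁹, Lüscher's LO trivializing map inside HMC, Engel–Schaefer 2011).  NEW WORK of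
the cell over the tree's `Exactness/LatticeSitePolynomials.lean` (`smonom`, `polyS`),
`Exactness/LatticeSiteDerivatives.lean` (`siteDeriv`, `siteEuler`, Euler's identity
`siteEuler_smonom`) and `Exactness/LatticeSitePolynomialLaplacian.lean` (`siteFlatLap`,
`ambSiteLap`, `siteLaplacian_eq_ambSiteLap`: E–S's `∂̃_k·∂̃_k = flatLap − E_k∘E_k − (d−2)E_k` on
the spheres); nothing is cited as a fact.  Printed counterpart, NAMED ONLY: M. Lüscher, Commun.
Math. Phys. 293 (2010) 899, §3.3 and §4.4 ("the Laplacian maps polynomials of degree `N` into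
polynomials of degree `N`"; the linear problem of each order is finite-dimensional); Engel–Schaefer,
Comput. Phys. Commun. 182 (2011) 2107, §3 (the display before eq. (15): `−∂̃_n·∂̃_n` reproduces a
site-linear functional times `d − 1 = 2N − 1`).  The numbers `ℓ(ℓ + d − 2)` are the classical
eigenvalues of the Laplace–Beltrami operator of `S^{d−1}` on spherical harmonics of degree `ℓ`;
here they enter only through Euler's identity, no harmonic analysis is used.

## Content (`E` a finite-dimensional real inner product space, `d = dim E`; `Λ` finite)

* `siteCount n κs` — the number `c_n` of factors of `smonom κs` at site `n`; `sum_siteCount`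
  (`Σ_n c_n = k`); **`eigLabel κs = Σ_n c_n (c_n + d − 2)`** — THE LABEL OF THE MONOMIAL;
  `eigLabel_ge` (`(d−1)k ≤ λ`), `eigLabel_le` (`λ ≤ k(k + d − 2)`), `eigLabel_eq_zero_iff`
  (`λ = 0 ↔ k = 0`, `d ≥ 2`), `le_eigLabel` (`d − 1 ≤ λ`, `k ≥ 1`) — BY THE DEGREE AND `d` ONLY.
* linearity of `siteDeriv`, `siteEuler`, `siteFlatLap`, `ambSiteLap` on smooth functionals;
  **`ambSiteLap_smonom`**: `ambSiteLap n m = siteFlatLap n m − c_n(c_n + d − 2)·m` (Euler's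
  identity twice); **`sum_ambSiteLap_smonom`**: `Σ_n ambSiteLap n m = Σ_n siteFlatLap n m − λ(m)·m`
  with `Σ_n siteFlatLap n m ∈ polyS (k − 2)`.
* **`polyLap Λ E N : polyS Λ E N →ₗ[ℝ] polyS Λ E N`**, `f ↦ −Σ_k ambSiteLap k f` — LÜSCHER'S
  `𝔏₀ = −Σ_k ∂̃_k·∂̃_k` AS A LINEAR ENDOMORPHISM OF THE LATTICE POLYNOMIALS OF DEGREE `≤ N`
  (`polyLap_apply_sphere`: on the product of unit spheres it IS `−Σ_k ∂̃_k·∂̃_k`);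
  **`polyLap_smonom`**: `𝔏 m = λ(m)·m − Σ_n siteFlatLap n m` — TRIANGULAR WITH RESPECT TO THE
  DEGREE WITH THE LABELS ON THE DIAGONAL — the input of `SphereLatticeLaplacianSpectrum` (every
  eigenvalue of `𝔏₀` on `polyS N`, on the spheres, is a label: `0` or in `[d−1, N(N+d−2)]`).

NOT CLAIMED: that every label is an eigenvalue (no harmonic projections are constructed);
anything about measures; anything quantitative about flows.
-/

noncomputable section

namespace Summit.Ventures.LatticeQCDFlow.Exactness

open Function Set
open scoped RealInnerProductSpace ContDiff

variable {Λ : Type*} {E : Type*} [NormedAddCommGroup E] [InnerProductSpace ℝ E]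

/-! ## §1 Multidegrees of site monomials and their labels -/

section Labels

variable [DecidableEq Λ]

/-- **The number of factors of the site monomial `smonom κs` at site `n`** (its degree in the
site-`n` coordinates), read as a real number. -/
def siteCount (n : Λ) {k : ℕ} (κs : Fin k → SiteCoord Λ E) : ℝ :=
  ∑ j, if (κs j).1 = n then (1 : ℝ) else 0

/-- `siteCount` is the cardinality of the set of factors sitting at `n`. -/
theorem siteCount_eq_card (n : Λ) {k : ℕ} (κs : Fin k → SiteCoord Λ E) :
    siteCount n κs = ((Finset.univ.filter fun j => (κs j).1 = n).card : ℝ) := by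
  unfold siteCount; rw [Finset.sum_boole]

/-- `c (c − 1) ≥ 0` for the natural number `c = siteCount n κs`. -/
theorem siteCount_mul_sub_one_nonneg (n : Λ) {k : ℕ} (κs : Fin k → SiteCoord Λ E) :
    0 ≤ siteCount n κs * (siteCount n κs - 1) := by
  rw [siteCount_eq_card]
  rcases (Finset.univ.filter fun j => (κs j).1 = n).card with _ | m
  · simp
  · exact mul_nonneg (by positivity) (by push_cast; linarith)

variable [Fintype Λ]

/-- **`Σ_n c_n = k`**: the site counts of a degree-`k` monomial add up to `k`. -/
theorem sum_siteCount {k : ℕ} (κs : Fin k → SiteCoord Λ E) : ∑ n, siteCount n κs = k := by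
  unfold siteCount
  rw [Finset.sum_comm]
  simp [Finset.sum_ite_eq]

/-- **THE LABEL OF A SITE MONOMIAL**: `λ = Σ_n c_n (c_n + d − 2)`, `d = dim E`, `c_n` the number
of factors at site `n` (`ℓ(ℓ + d − 2)` is the Laplace–Beltrami eigenvalue of `S^{d−1}` on degree-`ℓ`
harmonics; the label adds these over the sites). -/
def eigLabel {k : ℕ} (κs : Fin k → SiteCoord Λ E) : ℝ :=
  ∑ n, siteCount n κs * (siteCount n κs + (Module.finrank ℝ E : ℝ) - 2)

/-- `λ − (d − 1)·k = Σ_n c_n (c_n − 1)`. -/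
theorem eigLabel_sub_eq {k : ℕ} (κs : Fin k → SiteCoord Λ E) :
    eigLabel κs - ((Module.finrank ℝ E : ℝ) - 1) * k =
      ∑ n, siteCount n κs * (siteCount n κs - 1) := by
  unfold eigLabel
  rw [← sum_siteCount κs, Finset.mul_sum, ← Finset.sum_sub_distrib]
  exact Finset.sum_congr rfl fun n _ => by ring

/-- **Lower bound `(d − 1)·k ≤ λ`** (each site contributes `c_n(c_n + d − 2) ≥ (d − 1) c_n`). -/
theorem eigLabel_ge {k : ℕ} (κs : Fin k → SiteCoord Λ E) :
    ((Module.finrank ℝ E : ℝ) - 1) * k ≤ eigLabel κs := by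
  have h := eigLabel_sub_eq κs
  have h0 : 0 ≤ ∑ n, siteCount n κs * (siteCount n κs - 1) :=
    Finset.sum_nonneg fun n _ => siteCount_mul_sub_one_nonneg n κs
  linarith

/-- **Upper bound `λ ≤ k (k + d − 2)`** (`λ = Σ_n c_n² + (d−2)k` and `Σ_n c_n² ≤ k²`: all factors
at one site is the worst case). -/
theorem eigLabel_le {k : ℕ} (κs : Fin k → SiteCoord Λ E) :
    eigLabel κs ≤ (k : ℝ) * (k + (Module.finrank ℝ E : ℝ) - 2) := by
  have h1 : eigLabel κs = ∑ n, siteCount n κs ^ 2 + ((Module.finrank ℝ E : ℝ) - 2) * k := by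
    unfold eigLabel
    rw [← sum_siteCount κs, Finset.mul_sum, ← Finset.sum_add_distrib]
    exact Finset.sum_congr rfl fun n _ => by ring
  have h2 : ∑ n, siteCount n κs ^ 2 ≤ (k : ℝ) ^ 2 := by
    rw [← sum_siteCount κs]
    exact Finset.sum_sq_le_sq_sum_of_nonneg fun n _ => by rw [siteCount_eq_card]; positivity
  rw [h1]
  nlinarith

/-- The empty monomial (the constant `1`) has label `0`. -/
@[simp] theorem eigLabel_fin_zero (κs : Fin 0 → SiteCoord Λ E) : eigLabel κs = 0 := by
  simp [eigLabel, siteCount]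

/-- **`d − 1 ≤ λ` for a non-constant monomial** (`k ≥ 1`, `d ≥ 1`). -/
theorem le_eigLabel (h1 : 1 ≤ Module.finrank ℝ E) {k : ℕ} (hk : 1 ≤ k)
    (κs : Fin k → SiteCoord Λ E) : (Module.finrank ℝ E : ℝ) - 1 ≤ eigLabel κs := by
  have h := eigLabel_ge κs
  have hd : (1 : ℝ) ≤ Module.finrank ℝ E := by exact_mod_cast h1
  have hk' : (1 : ℝ) ≤ k := by exact_mod_cast hk
  nlinarith

/-- **`λ = 0 ↔ k = 0`** when `d ≥ 2`: the only monomial with label `0` is the constant. -/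
theorem eigLabel_eq_zero_iff (h2 : 2 ≤ Module.finrank ℝ E) {k : ℕ} (κs : Fin k → SiteCoord Λ E) :
    eigLabel κs = 0 ↔ k = 0 := by
  refine ⟨fun h => ?_, by rintro rfl; exact eigLabel_fin_zero κs⟩
  by_contra hk
  have : (2 : ℝ) ≤ Module.finrank ℝ E := by exact_mod_cast h2
  linarith [le_eigLabel (by omega) (Nat.one_le_iff_ne_zero.2 hk) κs]

/-- A label of a monomial of degree `k ≤ N` is at most `N (N + d − 2)` (`d ≥ 1`). -/
theorem eigLabel_le_of_le (h1 : 1 ≤ Module.finrank ℝ E) {k N : ℕ} (hk : k ≤ N)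
    (κs : Fin k → SiteCoord Λ E) :
    eigLabel κs ≤ (N : ℝ) * (N + (Module.finrank ℝ E : ℝ) - 2) := by
  have h := eigLabel_le κs
  rcases Nat.eq_or_lt_of_le hk with rfl | hlt
  · exact h
  · have hkN : (k : ℝ) + 1 ≤ N := by exact_mod_cast hlt
    have hd : (1 : ℝ) ≤ Module.finrank ℝ E := by exact_mod_cast h1
    have hk0 : (0 : ℝ) ≤ k := Nat.cast_nonneg k
    have hprod : 0 ≤ ((N : ℝ) - k) * ((N : ℝ) + k + (Module.finrank ℝ E : ℝ) - 2) :=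
      mul_nonneg (by linarith) (by linarith)
    nlinarith

end Labels

/-! ## §2 Linearity of the site operators on smooth functionals -/

section Linear

variable [Fintype Λ] [DecidableEq Λ]

/-- Additivity of the site derivative on smooth functionals. -/
theorem siteDeriv_add_of_contDiff {F G : (Λ → E) → ℝ} (hF : ContDiff ℝ ∞ F) (hG : ContDiff ℝ ∞ G)
    (k : Λ) (v : E) : siteDeriv k v (F + G) = siteDeriv k v F + siteDeriv k v G := by
  funext x
  exact siteDeriv_add v (differentiableAt_section hF x k _) (differentiableAt_section hG x k _)

/-- Homogeneity of the site derivative on smooth functionals. -/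
theorem siteDeriv_smul_of_contDiff {F : (Λ → E) → ℝ} (hF : ContDiff ℝ ∞ F) (k : Λ) (v : E)
    (c : ℝ) : siteDeriv k v (c • F) = c • siteDeriv k v F := by
  funext x
  rw [Pi.smul_apply, smul_eq_mul]
  exact siteDeriv_smul v c (differentiableAt_section hF x k _)

/-- Additivity of the Euler operator on smooth functionals. -/
theorem siteEuler_add_of_contDiff {F G : (Λ → E) → ℝ} (hF : ContDiff ℝ ∞ F) (hG : ContDiff ℝ ∞ G)
    (k : Λ) : siteEuler k (F + G) = siteEuler k F + siteEuler k G := by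
  funext x
  exact siteDeriv_add (x k) (differentiableAt_section hF x k _) (differentiableAt_section hG x k _)

/-- Homogeneity of the Euler operator on smooth functionals. -/
theorem siteEuler_smul_of_contDiff {F : (Λ → E) → ℝ} (hF : ContDiff ℝ ∞ F) (k : Λ) (c : ℝ) :
    siteEuler k (c • F) = c • siteEuler k F := by
  funext x
  rw [Pi.smul_apply, smul_eq_mul]
  exact siteDeriv_smul (x k) c (differentiableAt_section hF x k _)

omit [Fintype Λ] in
/-- The Euler operator of a constant vanishes. -/
theorem siteEuler_const (k : Λ) (c : ℝ) : siteEuler k (fun _ : Λ → E => c) = 0 := by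
  funext x
  simp only [siteEuler, siteDeriv_const, Pi.zero_apply]

variable [FiniteDimensional ℝ E]

/-- Additivity of the flat site Laplacian on smooth functionals. -/
theorem siteFlatLap_add {F G : (Λ → E) → ℝ} (hF : ContDiff ℝ ∞ F) (hG : ContDiff ℝ ∞ G) (k : Λ) :
    siteFlatLap k (F + G) = siteFlatLap k F + siteFlatLap k G := by
  funext x
  simp only [siteFlatLap, Pi.add_apply]
  rw [← Finset.sum_add_distrib]
  refine Finset.sum_congr rfl fun i _ => ?_
  rw [siteDeriv_add_of_contDiff hF hG, siteDeriv_add_of_contDiff (contDiff_siteDeriv hF k _)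
    (contDiff_siteDeriv hG k _)]
  rfl

/-- Homogeneity of the flat site Laplacian on smooth functionals. -/
theorem siteFlatLap_smul {F : (Λ → E) → ℝ} (hF : ContDiff ℝ ∞ F) (k : Λ) (c : ℝ) :
    siteFlatLap k (c • F) = c • siteFlatLap k F := by
  funext x
  simp only [siteFlatLap, Pi.smul_apply, smul_eq_mul, Finset.mul_sum]
  refine Finset.sum_congr rfl fun i _ => ?_
  rw [siteDeriv_smul_of_contDiff hF, siteDeriv_smul_of_contDiff (contDiff_siteDeriv hF k _)]
  rfl

/-- **Additivity of the ambient site operator** on smooth functionals. -/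
theorem ambSiteLap_add {F G : (Λ → E) → ℝ} (hF : ContDiff ℝ ∞ F) (hG : ContDiff ℝ ∞ G) (k : Λ) :
    ambSiteLap k (F + G) = ambSiteLap k F + ambSiteLap k G := by
  funext x
  simp only [ambSiteLap, Pi.add_apply, siteFlatLap_add hF hG, siteEuler_add_of_contDiff hF hG,
    siteEuler_add_of_contDiff (contDiff_siteEuler hF k) (contDiff_siteEuler hG k)]
  ring

/-- **Homogeneity of the ambient site operator** on smooth functionals. -/
theorem ambSiteLap_smul {F : (Λ → E) → ℝ} (hF : ContDiff ℝ ∞ F) (k : Λ) (c : ℝ) :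
    ambSiteLap k (c • F) = c • ambSiteLap k F := by
  funext x
  simp only [ambSiteLap, Pi.smul_apply, smul_eq_mul, siteFlatLap_smul hF,
    siteEuler_smul_of_contDiff hF, siteEuler_smul_of_contDiff (contDiff_siteEuler hF k)]
  ring

omit [Fintype Λ] in
/-- The ambient site operator kills constants. -/
theorem ambSiteLap_const (k : Λ) (c : ℝ) : ambSiteLap k (fun _ : Λ → E => c) = 0 := by
  funext x
  have h1 : siteFlatLap k (fun _ : Λ → E => c) x = 0 := by
    simp only [siteFlatLap, siteDeriv_const, siteDeriv_zero, Pi.zero_apply, Finset.sum_const_zero]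
  have h3 : siteEuler k (siteEuler k (fun _ : Λ → E => c)) = 0 := by
    rw [siteEuler_const]; exact siteEuler_zero k
  rw [ambSiteLap, h1, h3, siteEuler_const]
  simp

end Linear

/-! ## §3 The ambient site operator on a site monomial: Euler's identity twice -/

section Monomials

variable [FiniteDimensional ℝ E] [Fintype Λ] [DecidableEq Λ]

/-- Euler's identity in `•` form: `E_n m = c_n • m`. -/
theorem siteEuler_smonom_eq_smul (n : Λ) {k : ℕ} (κs : Fin k → SiteCoord Λ E) :
    siteEuler n (smonom κs) = siteCount n κs • smonom κs := by
  rw [siteEuler_smonom]; funext x; simp only [siteCount, Pi.smul_apply, smul_eq_mul]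

/-- **Euler twice**: `E_n (E_n m) = c_n² • m`. -/
theorem siteEuler_siteEuler_smonom (n : Λ) {k : ℕ} (κs : Fin k → SiteCoord Λ E) :
    siteEuler n (siteEuler n (smonom κs)) = (siteCount n κs ^ 2) • smonom κs := by
  rw [siteEuler_smonom_eq_smul, siteEuler_smul_of_contDiff (contDiff_smonom κs),
    siteEuler_smonom_eq_smul, smul_smul, sq]

/-- **THE AMBIENT SITE OPERATOR ON A MONOMIAL**:
`ambSiteLap n m = siteFlatLap n m − c_n (c_n + d − 2) • m`. -/
theorem ambSiteLap_smonom (n : Λ) {k : ℕ} (κs : Fin k → SiteCoord Λ E) :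
    ambSiteLap n (smonom κs) = siteFlatLap n (smonom κs) -
      (siteCount n κs * (siteCount n κs + (Module.finrank ℝ E : ℝ) - 2)) • smonom κs := by
  funext x
  have h1 := congrFun (siteEuler_siteEuler_smonom n κs) x
  have h2 := congrFun (siteEuler_smonom_eq_smul n κs) x
  simp only [Pi.smul_apply, smul_eq_mul] at h1 h2
  rw [ambSiteLap, h1, h2]
  simp only [Pi.sub_apply, Pi.smul_apply, smul_eq_mul]
  ring

/-- **Summed over the sites**: `Σ_n ambSiteLap n m = Σ_n siteFlatLap n m − λ(m) • m`. -/
theorem sum_ambSiteLap_smonom {k : ℕ} (κs : Fin k → SiteCoord Λ E) :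
    (fun x => ∑ n, ambSiteLap n (smonom κs) x) =
      (fun x => ∑ n, siteFlatLap n (smonom κs) x) - eigLabel κs • smonom κs := by
  funext x
  simp only [ambSiteLap_smonom, Pi.sub_apply, Pi.smul_apply, smul_eq_mul, Finset.sum_sub_distrib,
    eigLabel, Finset.sum_mul]

/-- The remainder `Σ_n siteFlatLap n m` has degree `≤ k − 2`. -/
theorem sum_siteFlatLap_smonom_mem {k : ℕ} (κs : Fin k → SiteCoord Λ E) :
    (fun x => ∑ n, siteFlatLap n (smonom κs) x) ∈ polyS Λ E (k - 2) := by
  have e : (fun x => ∑ n, siteFlatLap n (smonom κs) x) = ∑ n, siteFlatLap n (smonom κs) := by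
    funext x; simp only [Finset.sum_apply]
  rw [e]
  exact Submodule.sum_mem _ fun n _ => siteFlatLap_mem_polyS n (smonom_mem le_rfl κs)

end Monomials

/-! ## §4 `𝔏₀` as a linear endomorphism of `polyS N`; triangularity -/

section Operator

variable [FiniteDimensional ℝ E] [Fintype Λ] [DecidableEq Λ]

variable (Λ E) in
/-- The underlying function of `polyLap`: `f ↦ −Σ_k ambSiteLap k f`, which stays in `polyS N`
(`LatticeSitePolynomialLaplacian.sum_ambSiteLap_mem_polyS`). -/
def polyLapFun (N : ℕ) (f : polyS Λ E N) : polyS Λ E N :=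
  ⟨-fun x => ∑ k, ambSiteLap k (f : (Λ → E) → ℝ) x,
    (polyS Λ E N).neg_mem (sum_ambSiteLap_mem_polyS f.2)⟩

/-- Unfolding `polyLapFun`. -/
theorem coe_polyLapFun_apply {N : ℕ} (f : polyS Λ E N) (x : Λ → E) :
    ((polyLapFun Λ E N f : polyS Λ E N) : (Λ → E) → ℝ) x =
      -∑ k, ambSiteLap k (f : (Λ → E) → ℝ) x := rfl

/-- Additivity of `polyLapFun` (from `ambSiteLap_add`). -/
theorem polyLapFun_add {N : ℕ} (f g : polyS Λ E N) :
    polyLapFun Λ E N (f + g) = polyLapFun Λ E N f + polyLapFun Λ E N g := by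
  apply Subtype.ext
  funext x
  rw [Submodule.coe_add, Pi.add_apply, coe_polyLapFun_apply, coe_polyLapFun_apply,
    coe_polyLapFun_apply, Submodule.coe_add]
  have h : ∀ k, ambSiteLap k ((f : (Λ → E) → ℝ) + (g : (Λ → E) → ℝ)) =
      ambSiteLap k (f : (Λ → E) → ℝ) + ambSiteLap k (g : (Λ → E) → ℝ) :=
    fun k => ambSiteLap_add (contDiff_of_mem_polyS f.2) (contDiff_of_mem_polyS g.2) k
  simp only [h, Pi.add_apply, Finset.sum_add_distrib, neg_add]

/-- Homogeneity of `polyLapFun` (from `ambSiteLap_smul`). -/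
theorem polyLapFun_smul {N : ℕ} (c : ℝ) (f : polyS Λ E N) :
    polyLapFun Λ E N (c • f) = c • polyLapFun Λ E N f := by
  apply Subtype.ext
  funext x
  rw [Submodule.coe_smul, Pi.smul_apply, coe_polyLapFun_apply, coe_polyLapFun_apply,
    Submodule.coe_smul]
  have h : ∀ k, ambSiteLap k (c • (f : (Λ → E) → ℝ)) = c • ambSiteLap k (f : (Λ → E) → ℝ) :=
    fun k => ambSiteLap_smul (contDiff_of_mem_polyS f.2) k c
  simp only [h, Pi.smul_apply, smul_eq_mul, Finset.mul_sum, mul_neg]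

variable (Λ E) in
/-- **LÜSCHER'S OPERATOR ON THE LATTICE POLYNOMIALS OF DEGREE `≤ N`**: the linear endomorphism
`f ↦ −Σ_k ambSiteLap k f` of `polyS Λ E N` (on the product of unit spheres this is
`−Σ_k ∂̃_k·∂̃_k f`, `polyLap_apply_sphere`). -/
def polyLap (N : ℕ) : polyS Λ E N →ₗ[ℝ] polyS Λ E N where
  toFun := polyLapFun Λ E N
  map_add' := polyLapFun_add
  map_smul' := polyLapFun_smul

/-- Unfolding `polyLap`. -/
@[simp] theorem polyLap_apply {N : ℕ} (f : polyS Λ E N) (x : Λ → E) :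
    (polyLap Λ E N f : (Λ → E) → ℝ) x = -∑ k, ambSiteLap k (f : (Λ → E) → ℝ) x := rfl

/-- **On the product of unit spheres, `polyLap` IS `−Σ_k ∂̃_k·∂̃_k`.** -/
theorem polyLap_apply_sphere {N : ℕ} (f : polyS Λ E N) (ξ : Λ → Metric.sphere (0 : E) 1) :
    (polyLap Λ E N f : (Λ → E) → ℝ) (fun n => (ξ n : E)) =
      -∑ k, siteLaplacian k (f : (Λ → E) → ℝ) (fun n => (ξ n : E)) := by
  rw [polyLap_apply, sum_siteLaplacian_eq_sum_ambSiteLap (contDiff_of_mem_polyS f.2) fun k => by simp]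

/-- **TRIANGULARITY**: on a site monomial of degree `k ≤ N`,
`𝔏 m = λ(m) • m − Σ_n siteFlatLap n m`, the last term of degree `≤ k − 2`. -/
theorem polyLap_smonom {N k : ℕ} (hk : k ≤ N) (κs : Fin k → SiteCoord Λ E) :
    (polyLap Λ E N ⟨smonom κs, smonom_mem hk κs⟩ : (Λ → E) → ℝ) =
      eigLabel κs • smonom κs - fun x => ∑ n, siteFlatLap n (smonom κs) x := by
  funext x
  show -∑ n, ambSiteLap n (smonom κs) x = _
  have h := congrFun (sum_ambSiteLap_smonom κs) x
  simp only [Pi.sub_apply, Pi.smul_apply, smul_eq_mul] at h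
  rw [h]
  simp only [Pi.sub_apply, Pi.smul_apply, smul_eq_mul]
  ring

/-- **Triangularity, as elements of `polyS N`**: `(𝔏 − λ(m)) m` is minus the remainder, of
degree `≤ k − 2`. -/
theorem polyLap_smonom_sub_smul {N k : ℕ} (hk : k ≤ N) (κs : Fin k → SiteCoord Λ E) :
    polyLap Λ E N ⟨smonom κs, smonom_mem hk κs⟩ - eigLabel κs • ⟨smonom κs, smonom_mem hk κs⟩ =
      -⟨fun x => ∑ n, siteFlatLap n (smonom κs) x,
        polyS_mono (by omega) (sum_siteFlatLap_smonom_mem κs)⟩ := by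
  apply Subtype.ext
  rw [Submodule.coe_sub, Submodule.coe_smul, Submodule.coe_neg, polyLap_smonom hk κs]
  simp

/-- `𝔏` kills the constants. -/
theorem polyLap_const {N : ℕ} (c : ℝ) :
    polyLap Λ E N ⟨fun _ => c, const_mem_polyS N c⟩ = 0 := by
  apply Subtype.ext
  funext x
  simp [ambSiteLap_const]

/-- `𝔏` kills the empty monomial. -/
theorem polyLap_smonom_fin_zero {N : ℕ} (κs : Fin 0 → SiteCoord Λ E) :
    polyLap Λ E N ⟨smonom κs, smonom_mem (Nat.zero_le N) κs⟩ = 0 := by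
  have e : (⟨smonom κs, smonom_mem (Nat.zero_le N) κs⟩ : polyS Λ E N) =
      ⟨fun _ => (1 : ℝ), const_mem_polyS N 1⟩ := Subtype.ext (smonom_zero κs)
  rw [e, polyLap_const]

end Operator

end Summit.Ventures.LatticeQCDFlow.Exactness

end
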